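import Mathlib.Combinatorics.Enumerative.Partition.Basic
import Mathlib.Combinatorics.Young.YoungDiagram
import Mathlib.Data.Multiset.Sort
import Mathlib.Algebra.BigOperators.Group.Finset.Basic
import Mathlib.SetTheory.Cardinal.Finite
import HarnessLib

-- provenance: harness21/H21/H21/Prelude/ArithGeomL/PartitionTableaux.lean @ ab35c96 (interim HEAD d8f2665); M5 mechanical rewrite
-- wi-03866 (p2660 review): the five local rowOf/colOf/transpose API facts PROVED; two genuine
-- cites tagged (librarian-librarian-g10-0, 2026-08-13)
/-!
# Partition and tableau combinatorics (trunk ArithGeomL, item C7a)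

Pure combinatorics of integer partitions and Young tableaux shared by the `GL`-highest-weight
file (weights of partitions) and the symmetric-group file (Young symmetrizers): the parts of a
partition as a weakly decreasing list, the canonical row-reading tableau on `Fin d`, the Young
diagram of a partition, rectangles, the number of standard Young tableaux and hook lengths,
and the hook length formula.

## Sources

* W. Fulton, *Young Tableaux*, LMS Student Texts 35 (1997), §4.1, §7.2.
* J. S. Frame, G. de B. Robinson, R. M. Thrall, *The hook graphs of the symmetric group*,
  Canad. J. Math. 6 (1954), 316–324.
* G. D. James, *The Representation Theory of the Symmetric Groups*, LNM 682 (1978), §3, §20.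

## Mathlib

Mathlib has `Nat.Partition` (a multiset of positive parts), `YoungDiagram`,
`YoungDiagram.ofRowLens`, `YoungDiagram.rowLens`, `YoungDiagram.transpose` and
`SemistandardYoungTableau`, but (grep at this pin) no sorted parts of a `Nat.Partition`, no
Young diagram attached to a `Nat.Partition`, no standard Young tableaux, no hook lengths.
We use the Mathlib objects throughout.

## Design

* Declarations extending Mathlib's `Nat.Partition` are written `_root_.Nat.Partition.foo` inside
  `namespace Literature`: a deliberate dot-notation extension of a Mathlib namespace (H21 convention);
  none of these names exists in Mathlib. The remaining declarations live in `Literature.CplxAlg`.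
* `Nat.Partition.rowOf` / `Nat.Partition.colOf` describe the canonical row-reading tableau:
  the boxes of the Young diagram are numbered `0, …, d-1` row by row, and `i : Fin d` sits in
  box `(μ.rowOf i, μ.colOf i)`. The `ℕ`-subtraction in `colOf` is harmless: the subtrahend is
  `≤ i` by definition of `rowOf` (`Nat.Partition.sum_take_rowOf_le`).
* `numStandardTableaux μ` counts bijections `Fin d ≃ cells` such that the entries increase along
  rows and columns; the subtype is finite so `Nat.card` carries no junk value.
* `hookLength Y c` uses `ℕ`-subtraction; it is the genuine hook length (and is `≥ 1`) exactly
  for `c ∈ Y.cells`, and is only ever used on cells.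
-/

noncomputable section

open scoped BigOperators

namespace Literature.NumberTheory.DiophantineGeometry

variable {d : ℕ}

/-! ### Sorted parts -/

/-- The parts of a partition `μ ⊢ d` as a weakly decreasing list `μ₁ ≥ μ₂ ≥ ⋯`
(Fulton, *Young Tableaux*, §0). Declared in Mathlib's `Nat.Partition` namespace for dot
notation (H21 convention: deliberate extension). [folklore] -/
def _root_.Nat.Partition.sortedParts (μ : Nat.Partition d) : List ℕ :=
  μ.parts.sort (· ≥ ·)

/-- The sorted parts of a partition are weakly decreasing. Declared in Mathlib's
`Nat.Partition` namespace for dot notation (H21 convention: deliberate extension). [folklore] -/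
theorem _root_.Nat.Partition.sortedGE_sortedParts (μ : Nat.Partition d) :
    μ.sortedParts.SortedGE :=
  (Multiset.pairwise_sort _ _).sortedGE

/-- The number of sorted parts is the number of parts. Declared in Mathlib's `Nat.Partition`
namespace for dot notation (H21 convention: deliberate extension). [folklore] -/
@[simp]
theorem _root_.Nat.Partition.length_sortedParts (μ : Nat.Partition d) :
    μ.sortedParts.length = μ.parts.card :=
  Multiset.length_sort _

/-- The sorted parts of `μ ⊢ d` sum to `d`. Declared in Mathlib's `Nat.Partition` namespace
for dot notation (H21 convention: deliberate extension). [folklore] -/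
@[simp]
theorem _root_.Nat.Partition.sum_sortedParts (μ : Nat.Partition d) :
    μ.sortedParts.sum = d := by
  rw [Nat.Partition.sortedParts, ← Multiset.sum_coe, Multiset.sort_eq, μ.parts_sum]

/-- Every sorted part is positive. Declared in Mathlib's `Nat.Partition` namespace for dot
notation (H21 convention: deliberate extension). [folklore] -/
theorem _root_.Nat.Partition.pos_of_mem_sortedParts (μ : Nat.Partition d) {a : ℕ}
    (h : a ∈ μ.sortedParts) : 0 < a :=
  μ.parts_pos ((Multiset.mem_sort _).mp h)

/-! ### The canonical row-reading tableau -/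

/-- Row index of `i : Fin d` in the canonical row-reading tableau of shape `μ`: the boxes of the
Young diagram of `μ` are numbered `0, 1, …, d - 1` row by row (Fulton, *Young Tableaux*, §7.1),
and `μ.rowOf i` is the number of rows lying entirely before box `i`. Declared in Mathlib's
`Nat.Partition` namespace for dot notation (H21 convention: deliberate extension). [folklore] -/
def _root_.Nat.Partition.rowOf (μ : Nat.Partition d) (i : Fin d) : ℕ :=
  ((List.range μ.sortedParts.length).filter fun r ↦ (μ.sortedParts.take (r + 1)).sum ≤ i).length

/-- Filtering `[0, n)` by a downward-closed predicate `p` keeps an initial segment: for `r < n`,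
`p r` holds iff `r` is below the number of survivors. (Elementary; the counting behind
`Nat.Partition.rowOf`.) [folklore] -/
theorem length_filter_range_of_downward {p : ℕ → Prop} [DecidablePred p]
    (hp : ∀ a b, a ≤ b → p b → p a) (n : ℕ) :
    ∀ r < n, p r ↔ r < ((List.range n).filter fun r ↦ p r).length := by
  induction n with
  | zero => intro r hr; omega
  | succ n ih =>
    intro r hr
    rw [List.range_succ, List.filter_append, List.length_append]
    by_cases hn : p n
    · have hall : ((List.range n).filter fun r ↦ p r) = List.range n :=
        List.filter_eq_self.2 fun a ha ↦ by
          simpa using hp a n (List.mem_range.1 ha).le hn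
      simp only [hall, List.length_range, List.filter_singleton, hn, decide_true]
      exact ⟨fun _ ↦ hr, fun _ ↦ hp r n (Nat.lt_succ_iff.1 hr) hn⟩
    · simp only [List.filter_singleton, hn, decide_false]
      rcases (Nat.lt_succ_iff.1 hr).eq_or_lt with rfl | hr'
      · constructor
        · exact fun h ↦ (hn h).elim
        · intro h
          exact absurd ((List.length_filter_le _ _).trans_eq (List.length_range)) (not_le.2 h)
      · exact ih r hr'

/-- Characterisation of `rowOf`: for a row index `r`, the first `r + 1` rows hold at most `i`
boxes iff `r` lies strictly before the row of `i` (Fulton, *Young Tableaux*, §7.1, row-reading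
numbering). Declared in Mathlib's `Nat.Partition` namespace for dot notation (H21 convention:
deliberate extension). [folklore] -/
theorem _root_.Nat.Partition.sum_take_succ_le_iff_lt_rowOf (μ : Nat.Partition d) (i : Fin d)
    {r : ℕ} (hr : r < μ.sortedParts.length) :
    (μ.sortedParts.take (r + 1)).sum ≤ i ↔ r < μ.rowOf i :=
  length_filter_range_of_downward (p := fun r ↦ (μ.sortedParts.take (r + 1)).sum ≤ (i : ℕ))
    (fun _ _ hab hb ↦ (μ.sortedParts.monotone_sum_take (by omega)).trans hb) _ r hr

/-- `rowOf i` is at most the number of rows. Declared in Mathlib's `Nat.Partition` namespace for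
dot notation (H21 convention: deliberate extension). [folklore] -/
theorem _root_.Nat.Partition.rowOf_le_length (μ : Nat.Partition d) (i : Fin d) :
    μ.rowOf i ≤ μ.sortedParts.length :=
  (List.length_filter_le _ _).trans_eq List.length_range

/-- The boxes in the rows before the row of `i` number at most `i`. Declared in Mathlib's
`Nat.Partition` namespace for dot notation (H21 convention: deliberate extension). PROVED
(wi-03866). [folklore] -/
theorem _root_.Nat.Partition.sum_take_rowOf_le (μ : Nat.Partition d) (i : Fin d) :
    (μ.sortedParts.take (μ.rowOf i)).sum ≤ i := by
  rcases h : μ.rowOf i with _ | k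
  · simp
  · have hk : k < μ.sortedParts.length := by
      have := μ.rowOf_le_length i; omega
    exact (μ.sum_take_succ_le_iff_lt_rowOf i hk).2 (by omega)

/-- The row of any `i : Fin d` is a genuine row of `μ`. Declared in Mathlib's `Nat.Partition`
namespace for dot notation (H21 convention: deliberate extension). PROVED (wi-03866). [folklore] -/
theorem _root_.Nat.Partition.rowOf_lt_length (μ : Nat.Partition d) (i : Fin d) :
    μ.rowOf i < μ.sortedParts.length := by
  have hd : 0 < d := i.pos
  have hn : 0 < μ.sortedParts.length :=
    List.length_pos_of_sum_ne_zero _ (by rw [μ.sum_sortedParts]; exact hd.ne')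
  have key := μ.sum_take_succ_le_iff_lt_rowOf i (r := μ.sortedParts.length - 1) (by omega)
  rw [Nat.sub_add_cancel hn, List.take_length, μ.sum_sortedParts] at key
  have : ¬ (μ.sortedParts.length - 1 < μ.rowOf i) := fun h ↦ absurd (key.2 h) (by omega)
  omega

/-- Box `i` lies strictly before the end of its row: `i < μ₁ + ⋯ + μ_{rowOf i + 1}`. Declared in
Mathlib's `Nat.Partition` namespace for dot notation (H21 convention: deliberate extension).
[folklore] -/
theorem _root_.Nat.Partition.lt_sum_take_rowOf_succ (μ : Nat.Partition d) (i : Fin d) :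
    (i : ℕ) < (μ.sortedParts.take (μ.rowOf i + 1)).sum := by
  have key := μ.sum_take_succ_le_iff_lt_rowOf i (μ.rowOf_lt_length i)
  have : ¬ ((μ.sortedParts.take (μ.rowOf i + 1)).sum ≤ i) := fun h ↦ lt_irrefl _ (key.1 h)
  omega

/-- `rowOf` is determined by the bracketing `μ₁ + ⋯ + μ_r ≤ i < μ₁ + ⋯ + μ_{r+1}`. Declared in
Mathlib's `Nat.Partition` namespace for dot notation (H21 convention: deliberate extension).
[folklore] -/
theorem _root_.Nat.Partition.rowOf_eq_of_le_of_lt (μ : Nat.Partition d) (i : Fin d) {r : ℕ}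
    (hr : r < μ.sortedParts.length) (h₁ : (μ.sortedParts.take r).sum ≤ i)
    (h₂ : (i : ℕ) < (μ.sortedParts.take (r + 1)).sum) : μ.rowOf i = r := by
  have hle : μ.rowOf i ≤ r := by
    have := (μ.sum_take_succ_le_iff_lt_rowOf i hr).not.1 (by omega)
    omega
  rcases r with _ | k
  · omega
  · have := (μ.sum_take_succ_le_iff_lt_rowOf i (r := k) (by omega)).1 h₁
    omega

/-- Column index of `i : Fin d` in the canonical row-reading tableau of shape `μ`
(Fulton, *Young Tableaux*, §7.1): `i` minus the number of boxes in the earlier rows. The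
`ℕ`-subtraction is harmless by `Nat.Partition.sum_take_rowOf_le`. Declared in Mathlib's
`Nat.Partition` namespace for dot notation (H21 convention: deliberate extension). [folklore] -/
def _root_.Nat.Partition.colOf (μ : Nat.Partition d) (i : Fin d) : ℕ :=
  (i : ℕ) - (μ.sortedParts.take (μ.rowOf i)).sum

/-- Row-reading numbering: `i = (μ₁ + ⋯ + μ_{rowOf i}) + colOf i` (Fulton, *Young Tableaux*,
§7.1). Declared in Mathlib's `Nat.Partition` namespace for dot notation (H21 convention:
deliberate extension). [folklore] -/
theorem _root_.Nat.Partition.val_eq_sum_take_rowOf_add_colOf (μ : Nat.Partition d) (i : Fin d) :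
    (i : ℕ) = (μ.sortedParts.take (μ.rowOf i)).sum + μ.colOf i := by
  have := μ.sum_take_rowOf_le i
  simp only [Nat.Partition.colOf]
  omega

/-! ### The Young diagram of a partition -/

/-- The sum of the row lengths of a Young diagram is its number of boxes. Declared in Mathlib's
`YoungDiagram` namespace for dot notation (H21 convention: deliberate extension; not in Mathlib
at this pin). [folklore] -/
theorem _root_.YoungDiagram.sum_rowLens (Y : YoungDiagram) : Y.rowLens.sum = Y.cells.card := by
  classical
  have hmaps : (Y.cells : Set (ℕ × ℕ)).MapsTo Prod.fst (Finset.range (Y.colLen 0)) := by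
    rintro ⟨i, j⟩ h
    simp only [Finset.coe_range, Set.mem_Iio]
    exact (YoungDiagram.mem_iff_lt_colLen.mp h).trans_le (Y.colLen_anti 0 j j.zero_le)
  rw [Finset.card_eq_sum_card_fiberwise hmaps, Finset.sum_eq_multiset_sum, Finset.range_val,
    ← Multiset.coe_range, Multiset.map_coe, Multiset.sum_coe, YoungDiagram.rowLens]
  congr 1
  refine List.map_congr_left fun i _ ↦ ?_
  rw [Y.rowLen_eq_card]
  rfl

/-- Transposition preserves the number of boxes of a Young diagram. Declared in Mathlib's
`YoungDiagram` namespace for dot notation (H21 convention: deliberate extension; not in Mathlib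
at this pin). [folklore] -/
@[simp]
theorem _root_.YoungDiagram.card_transpose (Y : YoungDiagram) :
    Y.transpose.cells.card = Y.cells.card := by
  simp [YoungDiagram.transpose]

/-- The Young diagram of a partition `μ ⊢ d`: row `r` has `μ_{r+1}` boxes, parts in decreasing
order (Fulton, *Young Tableaux*, §0; Mathlib `YoungDiagram.ofRowLens`). Declared in Mathlib's
`Nat.Partition` namespace for dot notation (H21 convention: deliberate extension). [folklore] -/
def _root_.Nat.Partition.youngDiagram (μ : Nat.Partition d) : YoungDiagram :=
  YoungDiagram.ofRowLens μ.sortedParts μ.sortedGE_sortedParts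

/-- The row lengths of the Young diagram of `μ` are the sorted parts of `μ`. Declared in
Mathlib's `Nat.Partition` namespace for dot notation (H21 convention: deliberate extension).
[folklore] -/
@[simp]
theorem _root_.Nat.Partition.rowLens_youngDiagram (μ : Nat.Partition d) :
    μ.youngDiagram.rowLens = μ.sortedParts :=
  YoungDiagram.rowLens_ofRowLens_eq_self fun _ h ↦ μ.pos_of_mem_sortedParts h

/-- Membership in the Young diagram of `μ`: `(r, c)` is a box iff `r` is a row and `c < μ_{r+1}`.
Declared in Mathlib's `Nat.Partition` namespace for dot notation (H21 convention: deliberate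
extension). [folklore] -/
theorem _root_.Nat.Partition.mem_youngDiagram_iff (μ : Nat.Partition d) (c : ℕ × ℕ) :
    c ∈ μ.youngDiagram ↔ ∃ h : c.1 < μ.sortedParts.length, c.2 < μ.sortedParts[c.1] :=
  YoungDiagram.mem_ofRowLens

/-- The Young diagram of `μ ⊢ d` has `d` boxes. Declared in Mathlib's `Nat.Partition`
namespace for dot notation (H21 convention: deliberate extension). [folklore] -/
theorem _root_.Nat.Partition.card_cells_youngDiagram (μ : Nat.Partition d) :
    μ.youngDiagram.cells.card = d := by
  rw [← YoungDiagram.sum_rowLens, μ.rowLens_youngDiagram, μ.sum_sortedParts]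

/-- The canonical row-reading tableau lands in the Young diagram: `(μ.rowOf i, μ.colOf i)` is a
box of `μ.youngDiagram` (Fulton, *Young Tableaux*, §7.1). Declared in Mathlib's `Nat.Partition`
namespace for dot notation (H21 convention: deliberate extension). PROVED (wi-03866). [folklore] -/
theorem _root_.Nat.Partition.rowOf_colOf_mem_youngDiagram (μ : Nat.Partition d) (i : Fin d) :
    (μ.rowOf i, μ.colOf i) ∈ μ.youngDiagram := by
  rw [Nat.Partition.mem_youngDiagram_iff]
  refine ⟨μ.rowOf_lt_length i, ?_⟩
  have h₁ := μ.lt_sum_take_rowOf_succ i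
  rw [List.sum_take_succ _ _ (μ.rowOf_lt_length i)] at h₁
  have h₂ := μ.sum_take_rowOf_le i
  simp only [Nat.Partition.colOf]
  omega

/-- A box `c` of the Young diagram of `μ` is the position of exactly one `i : Fin d` in the
canonical row-reading tableau (Fulton, *Young Tableaux*, §7.1). Declared in Mathlib's
`Nat.Partition` namespace for dot notation (H21 convention: deliberate extension). PROVED
(wi-03866): the preimage of `(r, s)` is `i = μ₁ + ⋯ + μ_r + s`. [folklore] -/
theorem _root_.Nat.Partition.mem_youngDiagram_iff_existsUnique_rowOf_colOf (μ : Nat.Partition d)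
    (c : ℕ × ℕ) : c ∈ μ.youngDiagram ↔ ∃! i : Fin d, (μ.rowOf i, μ.colOf i) = c := by
  constructor
  · obtain ⟨r, s⟩ := c
    rw [Nat.Partition.mem_youngDiagram_iff]
    rintro ⟨hr, hs⟩
    simp only at hr hs
    have hlt : (μ.sortedParts.take r).sum + s < d := by
      calc (μ.sortedParts.take r).sum + s < (μ.sortedParts.take (r + 1)).sum := by
            rw [List.sum_take_succ _ _ hr]; omega
        _ ≤ (μ.sortedParts.take μ.sortedParts.length).sum :=
            μ.sortedParts.monotone_sum_take (by omega)
        _ = d := by rw [List.take_length, μ.sum_sortedParts]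
    have hrow : μ.rowOf ⟨_, hlt⟩ = r :=
      μ.rowOf_eq_of_le_of_lt _ hr (by simp) (by simp only; rw [List.sum_take_succ _ _ hr]; omega)
    refine ⟨⟨_, hlt⟩, ?_, ?_⟩
    · simp only [Nat.Partition.colOf, hrow, Prod.mk.injEq, true_and]
      omega
    · rintro j hj
      simp only [Prod.mk.injEq] at hj
      obtain ⟨hjr, hjs⟩ := hj
      ext
      have := μ.val_eq_sum_take_rowOf_add_colOf j
      rw [hjr, hjs] at this
      simpa using this
  · rintro ⟨i, hi, -⟩
    rw [← hi]
    exact μ.rowOf_colOf_mem_youngDiagram i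

/-! ### Rectangles -/

/-- The `a × b` rectangular partition `(b, b, …, b)` (`a` parts equal to `b`) of `a * b`; it is
the empty partition if `b = 0` (Mathlib's `Nat.Partition.ofSums` discards zero parts)
(Fulton, *Young Tableaux*, §0). Declared in Mathlib's `Nat.Partition` namespace for dot notation
(H21 convention: deliberate extension). [folklore] -/
def _root_.Nat.Partition.rectangle (a b : ℕ) : Nat.Partition (a * b) :=
  Nat.Partition.ofSums (a * b) (Multiset.replicate a b) (by simp)

/-! ### Transpose -/

/-- The transpose (conjugate) partition `μ'` of `μ ⊢ d`: its parts are the column lengths of the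
Young diagram of `μ`, i.e. the row lengths of `μ.youngDiagram.transpose`
(Fulton, *Young Tableaux*, §0). Declared in Mathlib's `Nat.Partition` namespace for dot notation
(H21 convention: deliberate extension). [folklore] -/
def _root_.Nat.Partition.transpose (μ : Nat.Partition d) : Nat.Partition d where
  parts := (μ.youngDiagram.transpose.rowLens : Multiset ℕ)
  parts_pos h := μ.youngDiagram.transpose.pos_of_mem_rowLens _ (Multiset.mem_coe.mp h)
  parts_sum := by
    rw [Multiset.sum_coe, YoungDiagram.sum_rowLens, YoungDiagram.card_transpose,
      μ.card_cells_youngDiagram]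

/-- The Young diagram of the transpose partition is the transpose Young diagram. Declared in
Mathlib's `Nat.Partition` namespace for dot notation (H21 convention: deliberate extension).
PROVED (wi-03866): the transpose row lengths are already sorted, so sorting is the identity
(`List.mergeSort_eq_self`) and `YoungDiagram.ofRowLens_to_rowLens_eq_self` applies. [folklore] -/
theorem _root_.Nat.Partition.sortedParts_transpose (μ : Nat.Partition d) :
    μ.transpose.sortedParts = μ.youngDiagram.transpose.rowLens := by
  change Multiset.sort (μ.youngDiagram.transpose.rowLens : Multiset ℕ) (· ≥ ·) = _
  rw [Multiset.coe_sort]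
  exact List.mergeSort_eq_self _ (YoungDiagram.rowLens_sorted _).pairwise

/-- The Young diagram of the transpose partition is the transpose Young diagram
(Fulton, *Young Tableaux*, §0). Declared in Mathlib's `Nat.Partition` namespace for dot notation
(H21 convention: deliberate extension). PROVED (wi-03866). [folklore] -/
theorem _root_.Nat.Partition.youngDiagram_transpose (μ : Nat.Partition d) :
    μ.transpose.youngDiagram = μ.youngDiagram.transpose := by
  have key : ∀ (l₁ l₂ : List ℕ) (h₁ : l₁.SortedGE) (h₂ : l₂.SortedGE), l₁ = l₂ →
      YoungDiagram.ofRowLens l₁ h₁ = YoungDiagram.ofRowLens l₂ h₂ := by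
    rintro l₁ l₂ h₁ h₂ rfl; rfl
  exact (key _ _ _ (YoungDiagram.rowLens_sorted _) μ.sortedParts_transpose).trans
    YoungDiagram.ofRowLens_to_rowLens_eq_self

/-! ### Standard Young tableaux and hook lengths -/

section CplxAlg

/-- A bijective filling `f : Fin d ≃ Y.cells` of a Young diagram with `d` boxes by `0, …, d-1`
is *standard* if the entries increase along each row and down each column; equivalently
(the diagram being a lower set) a larger entry never lies weakly north-west of a smaller one
(Fulton, *Young Tableaux*, §0; James, LNM 682, §3). [folklore] -/
def IsStandardFilling (Y : YoungDiagram) (f : Fin d ≃ Y.cells) : Prop :=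
  ∀ i j : Fin d, i < j → ¬ ((f j : ℕ × ℕ).1 ≤ (f i : ℕ × ℕ).1 ∧ (f j : ℕ × ℕ).2 ≤ (f i : ℕ × ℕ).2)

/-- The number `f^μ` of standard Young tableaux of shape `μ ⊢ d`: bijective fillings of the
Young diagram of `μ` by `0, …, d - 1` increasing along rows and columns
(Fulton, *Young Tableaux*, §7.2; James, LNM 682, §3). The subtype is finite, so `Nat.card`
carries no junk value. [folklore] -/
def numStandardTableaux (μ : Nat.Partition d) : ℕ :=
  Nat.card {f : Fin d ≃ μ.youngDiagram.cells // IsStandardFilling μ.youngDiagram f}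

/-- The hook length of the box `c = (r, s)` of a Young diagram `Y`: the number of boxes weakly to
the right of `c` in its row plus those strictly below `c` in its column
(Frame–Robinson–Thrall 1954; Fulton, *Young Tableaux*, §4.1). Uses `ℕ`-subtraction: it is the
genuine hook length, and is `≥ 1`, exactly for `c ∈ Y.cells` (`one_le_hookLength`); off the
diagram it is a junk value. [cite: FrameRobinsonThrallCJM1954, §2] -/
def hookLength (Y : YoungDiagram) (c : ℕ × ℕ) : ℕ :=
  (Y.rowLen c.1 - c.2) + (Y.colLen c.2 - c.1) - 1

/-- Hook lengths of boxes of the diagram are at least `1` (the box itself lies in its hook)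
(Fulton, *Young Tableaux*, §4.1). [folklore] -/
theorem one_le_hookLength {Y : YoungDiagram} {c : ℕ × ℕ} (hc : c ∈ Y.cells) :
    1 ≤ hookLength Y c := by
  obtain ⟨i, j⟩ := c
  have h₁ : j < Y.rowLen i := YoungDiagram.mem_iff_lt_rowLen.mp hc
  have h₂ : i < Y.colLen j := YoungDiagram.mem_iff_lt_colLen.mp hc
  simp only [hookLength]
  omega

/-- The **hook length formula** (Frame–Robinson–Thrall, Canad. J. Math. 6 (1954); Fulton,
*Young Tableaux*, §7.2, Corollary; James, LNM 682, Theorem 20.1), in division-free form: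
`f^μ · ∏_{c ∈ μ} h(c) = d!`. Named fact (nothing asserted).
[cite: FrameRobinsonThrallCJM1954, Theorem 1] -/
def numStandardTableaux_mul_prod_hookLength : Prop :=
  ∀ (μ : Nat.Partition d),
    numStandardTableaux μ * ∏ c ∈ μ.youngDiagram.cells, hookLength μ.youngDiagram c =
      d.factorial

/-- Every shape has at least one standard Young tableau (e.g. the row-reading tableau)
(Fulton, *Young Tableaux*, §7.2, first paragraph: `f^λ ≥ 1`, witnessed by the row-reading
tableau). Named fact (nothing asserted). [cite: FultonYoungTableaux1997, §7.2] -/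
def numStandardTableaux_pos : Prop :=
  ∀ (μ : Nat.Partition d),
    0 < numStandardTableaux μ

end CplxAlg

/-! ### Discharge: every shape carries a standard Young tableau

Fulton numbers the boxes of a Young diagram "by rows, from left to right and top to bottom"
(*Young Tableaux*, §7.3, proof of the Theorem; the numbering `T` used to realise `M^λ` as an
induced representation); this numbering is a standard tableau on every shape, so `f^λ ≥ 1`
(equivalently, by the hook length formula of §4.3, `f^λ = n!/∏ h(i,j)` is a positive integer).
Here the row-reading numbering is `i ↦ (μ.rowOf i, μ.colOf i)` (with entries `0, …, d - 1`). -/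

/-- The canonical row-reading numbering `i ↦ (μ.rowOf i, μ.colOf i)` of the Young diagram of
`μ ⊢ d` is a bijection from `Fin d` onto the boxes and is a standard filling: along the
row-reading order both coordinates are (weakly) monotone in the sense that a later entry never
lies weakly north-west of an earlier one (Fulton, *Young Tableaux*, §7.3, proof of the Theorem:
"the numbering T by rows, from left to right and top to bottom").
[cite: FultonYoungTableaux1997, §7.3] -/
theorem exists_isStandardFilling_rowOf_colOf (μ : Nat.Partition d) :
    ∃ f : Fin d ≃ μ.youngDiagram.cells,
      IsStandardFilling μ.youngDiagram f ∧
        ∀ i, ((f i : μ.youngDiagram.cells) : ℕ × ℕ) = (μ.rowOf i, μ.colOf i) := by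
  let g : Fin d → μ.youngDiagram.cells :=
    fun i ↦ ⟨(μ.rowOf i, μ.colOf i), μ.rowOf_colOf_mem_youngDiagram i⟩
  have hg : ∀ i, ((g i : μ.youngDiagram.cells) : ℕ × ℕ) = (μ.rowOf i, μ.colOf i) := fun _ ↦ rfl
  have hbij : Function.Bijective g := by
    refine ⟨fun i j hij ↦ ?_, fun c ↦ ?_⟩
    · obtain ⟨k, -, hk⟩ := (μ.mem_youngDiagram_iff_existsUnique_rowOf_colOf _).1
        (μ.rowOf_colOf_mem_youngDiagram i)
      have hj : (μ.rowOf j, μ.colOf j) = (μ.rowOf i, μ.colOf i) := by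
        rw [← hg j, ← hg i, hij]
      exact (hk i rfl).trans (hk j hj).symm
    · obtain ⟨i, hi, -⟩ := (μ.mem_youngDiagram_iff_existsUnique_rowOf_colOf _).1
        ((YoungDiagram.mem_cells _).1 c.2)
      exact ⟨i, Subtype.ext (by rw [hg, hi])⟩
  refine ⟨Equiv.ofBijective g hbij, fun i j hij h ↦ ?_,
    fun i ↦ by rw [Equiv.ofBijective_apply, hg]⟩
  rw [Equiv.ofBijective_apply, Equiv.ofBijective_apply, hg, hg] at h
  obtain ⟨hr, hc⟩ := h
  have hi := μ.val_eq_sum_take_rowOf_add_colOf i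
  have hj := μ.val_eq_sum_take_rowOf_add_colOf j
  have hmono : (μ.sortedParts.take (μ.rowOf j)).sum ≤ (μ.sortedParts.take (μ.rowOf i)).sum :=
    μ.sortedParts.monotone_sum_take hr
  have hlt : (i : ℕ) < j := Fin.lt_def.1 hij
  omega

/-- **Discharge** of `numStandardTableaux_pos`: every shape `μ ⊢ d` has at least one standard
Young tableau, namely the row-reading tableau `i ↦ (μ.rowOf i, μ.colOf i)`
(`exists_isStandardFilling_rowOf_colOf`); the type of standard fillings is a subtype of the
finite type `Fin d ≃ μ.youngDiagram.cells`, so its `Nat.card` is positive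
(Fulton, *Young Tableaux*, §7.3, proof of the Theorem, "the numbering T by rows, from left to
right and top to bottom"; cf. §4.3, hook length formula, and §7.2, Proposition 2,
`dim S^λ = f^λ`). [cite: FultonYoungTableaux1997, §7.3] -/
theorem numStandardTableaux_pos_holds : numStandardTableaux_pos (d := d) := by
  intro μ
  obtain ⟨f, hf, -⟩ := exists_isStandardFilling_rowOf_colOf μ
  haveI : Nonempty {f : Fin d ≃ μ.youngDiagram.cells // IsStandardFilling μ.youngDiagram f} :=
    ⟨⟨f, hf⟩⟩
  exact Nat.card_pos

end Literature.NumberTheory.DiophantineGeometry
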